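import Summits.Ventures.PercRepro.C025ProfilePLDSimplePaving
import Summits.Ventures.PercRepro.C025ProfilePLDClosureParallel

/-!
# C-025 ON EVERY TRUNCATION OF «SIMPLIFICATION-PAVING ⊕ PARALLEL CLASSES ⊕ FREE POINTS» (night-3 g30)

`proofs/NIGHT3-G30-PAREXT.md` §2.  The two closure theorems compose: g29's `PLDClosure.pld_disjointSum_parallelClasses`
(PER-LAYER DOMINANCE survives a direct sum with parallel classes) applied to `PLDParExt.pld_of_simplification_paving` /
`PLDParExt.pld_of_eRank_le_three` gives (PLD) for «M ⊕ parallel classes» with `M` of simplification paving or of rank `≤ 3`,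
and the landed bridge gives C-025 at every `(p, q)` on every truncation of the sum with free points.
No `def`, no `instance`, no notation.  Axioms: standard.
-/

open scoped Matroid

namespace PercRepro

open Finset ThmH

namespace PLDParExt

variable {α β : Type} [DecidableEq α] [DecidableEq β]

/-- C-025 AT EVERY `(p, q)` ON EVERY TRUNCATION OF «M ⊕ PARALLEL CLASSES ⊕ FREE POINTS» for every finite matroid `M`
whose simplification is paving. -/
theorem rls_truncate_simplificationPaving_parallelClasses_freeOn (M : Matroid α) [M.Finite]
    (hsp : ∀ C, M.IsCircuit C → C.encard ≤ 2 ∨ M.eRank ≤ C.encard)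
    (c : α → β) (E₂ : Finset α) (h : Disjoint M.E (E₂ : Set α)) (E₃ : Finset α)
    (h₃ : Disjoint (M.disjointSum ((Matroid.freeOn (Set.univ : Set β)).comapOn (E₂ : Set α) c) h).E (E₃ : Set α))
    (r p q : ℕ) :
    haveI := PLDClosure.disjointSum_comapOn_finite M c E₂ h
    haveI := PLDBridge.disjointSum_freeOn_finite _ E₃ h₃
    ThmN.RLS (PercRepro.Matroid.truncate
      ((M.disjointSum ((Matroid.freeOn (Set.univ : Set β)).comapOn (E₂ : Set α) c) h).disjointSum
        (Matroid.freeOn (E₃ : Set α)) h₃) r) p q :=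
  PLDClosure.rls_truncate_disjointSum_parallelClasses_freeOn_of_pld M (pld_of_simplification_paving M hsp) c E₂ h E₃ h₃
    r p q

/-- C-025 AT EVERY `(p, q)` ON EVERY TRUNCATION OF «M ⊕ PARALLEL CLASSES ⊕ FREE POINTS» for every finite matroid `M` of
rank `≤ 3`. -/
theorem rls_truncate_eRank_le_three_parallelClasses_freeOn (M : Matroid α) [M.Finite] (h3 : M.eRank ≤ 3)
    (c : α → β) (E₂ : Finset α) (h : Disjoint M.E (E₂ : Set α)) (E₃ : Finset α)
    (h₃ : Disjoint (M.disjointSum ((Matroid.freeOn (Set.univ : Set β)).comapOn (E₂ : Set α) c) h).E (E₃ : Set α))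
    (r p q : ℕ) :
    haveI := PLDClosure.disjointSum_comapOn_finite M c E₂ h
    haveI := PLDBridge.disjointSum_freeOn_finite _ E₃ h₃
    ThmN.RLS (PercRepro.Matroid.truncate
      ((M.disjointSum ((Matroid.freeOn (Set.univ : Set β)).comapOn (E₂ : Set α) c) h).disjointSum
        (Matroid.freeOn (E₃ : Set α)) h₃) r) p q :=
  PLDClosure.rls_truncate_disjointSum_parallelClasses_freeOn_of_pld M (pld_of_eRank_le_three M h3) c E₂ h E₃ h₃ r p q

end PLDParExt

end PercRepro
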